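import Literature.Probability.Percolation.PivotalLowerBoundFromSeparation
import Literature.Probability.Percolation.NearCriticalFourArmQuasiMult
import Literature.Probability.Percolation.RhombusPivotalSumWerner
import HarnessLib

/-!
# Werner's Lemma 6.2 for the rhombus (`Werner2009_lemma62`) from near-critical four-arm separation

Topic `Literature/Probability/Percolation`; family `crit-perc`. PROOFS ONLY (no definition, no
named fact). The state of the discharge of the named fact `Werner2009_lemma62`
(`KestenRelationRusso.lean`; W. Werner, *Lectures on two-dimensional critical percolation*,
PCMI 2009, Lecture 6, Lemma 6.2 read for the rhombus `[0, N]²` as in P. Nolin, *Near-critical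
percolation in two dimensions*, EJP 13 (2008), §7.3, Remark 35 [arXiv 0711.4948: Remark 34]:
`Σ_{v ∈ [0,N]²} P_t(v pivotal for LR([0, N]²)) ≍ N² π₄(N)` uniformly for `N ≤ L_ε(t)`).

`RhombusPivotalSumWerner.lean` reduced `Werner2009_lemma62` to the named fact
`Werner2009_fourArm_quasiMult` (Werner, Cor. 6.2) and ONE explicit hypothesis `hP`: the interior
sites `v` of the rhombus (`N/4 < v₀, v₁ < 3N/4`) are pivotal for `LR(N, N) = triLRCrossing N N`
with probability `≥ c · π̂_t(r₀, N)` uniformly below Werner's length (the last display of the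
proof of Nolin's Prop. 34 [arXiv: Prop. 32], `P̂(v ⇝⁴ ∂[0, L]²) ≍ P̂(v ⇝⁴ ∂S_{ηL}(v))`; Werner's
proof of Lemma 6.2, "the contribution of the `O(n²)` points `x` that are at distance more than
`n/4` of the boundary … is at least `π̂_p(n)`"). Meanwhile the tree reduced BOTH remaining named
facts of Kesten's near-critical arm calculus to one explicit hypothesis, the comparability below
`L(p)` of the well-separated four-arm event `sepFourArm n N` (`ArmSeparationFourArm.lean`) with the
four-arm event (Nolin's arm-separation theorem, Thm. 11 [arXiv: Thm. 10], `j = 4`, near-critical;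
Werner's Prop. 6.1): `Werner2009_fourArm_quasiMult_of_separation`
(`NearCriticalFourArmQuasiMult.lean`) and, for the `2N × N` PARALLELOGRAM,
`Werner2009_pivotal_lowerBound_of_separation` (`PivotalLowerBoundFromSeparation.lean`, with the
deterministic gluing `isPivotal_of_pivEvent` of `PivotalFromSeparatedArms.lean`).

This file runs the same gluing for the RHOMBUS and concludes:

* `paraHalfArm_of_framePath_gen` — `paraHalfArm_of_framePath` for a general parallelogram
  `R(m, n)` (same proof);
* `mem_paraFourArms_rhombus_of_glue`, `isPivotal_rhombus_of_glue` — **deterministic half**: if the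
  configuration seen from the interior site `v = (a, b)` of `[0, N]²` (`N < 4a < 3N`,
  `N < 4b < 3N`) lies in `sepFourArm n (64q)` and in the four half-arm gluing events
  `pivHalfGlue` of frames `0, 3` (open, targets `x₀ = N - a`, `x₀ = a`) and `1, 4` (closed,
  targets `x₀ + x₁ = N - b`, `x₀ + x₁ = b`), `64 ≤ n ≤ 64q`, `512q ≤ N`, then
  `ω ∈ paraFourArms N N v` and `v` is pivotal for `LR(N, N)` (the proof of
  `mem_paraFourArms_of_pivEvent` with the right target at `x₀ = N - a` instead of `2N - a`);
* `rhombus_pivotal_lowerBound_of_separation` — **probabilistic half**: the hypothesis `hP` of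
  `Werner2009_lemma62_of_quasiMult_of_rhombus_pivotal` follows from near-critical four-arm
  separation (the proof of `Werner2009_pivotal_lowerBound_of_separation` verbatim: `q = ⌊N/512⌋`,
  monotonicity in the outer radius, `real_pivEvent_ge` = Nolin's Lemma 13 with the corridor
  lengths `N - a, a, N - b, b`, RSW below `L(p)` for the slabs, the cost `(1/4)^{#block}` of the
  inner blocks, translation invariance);
* `Werner2009_lemma62_of_separation` — **`Werner2009_lemma62` follows from near-critical four-arm
  separation alone**, the same single hypothesis as `Werner2009_lemma62P_of_separation`,
  `Werner2009_lemma63_of_separation`, `Nolin2008_prop34_of_separation`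
  (`KestenScalingFromSeparation.lean`). The discharge `Werner2009_lemma62_holds` is this theorem
  applied to the near-critical four-arm separation theorem once that lands.

## References

* W. Werner, *Lectures on two-dimensional critical percolation*, IAS/Park City Math. Ser. 16
  (2009), Lecture 6, Lemma 6.2 (and its proof, lower bound), §4 Prop. 6.1, Cor. 6.1–6.2
  [WernerPCMI2009].
* P. Nolin, Near-critical percolation in two dimensions, *Electron. J. Probab.* 13 (2008)
  1562–1623, Rem. 9, §4.3 Thm. 11, Prop. 12, Lemma 13, §7.3 proof of Prop. 34 (last display) and
  Remark 35 (arXiv 0711.4948: Rem. 8, Thm. 10, Prop. 11, Lemma 12, Prop. 32, Remark 34) [Nolin2008].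
* H. Kesten, Scaling relations for 2D-percolation, *Comm. Math. Phys.* 109 (1987) 109–156,
  Lemmas 4–6 and 8 [KestenScalingCMP1987].

Tree: `pivHalfGlue`, `pivFrameEvent`, `pivInnerFinset`, `pivFrame_path`,
`triNorm_bounds_of_mem_pivInnerFinset`, `triRotIsoPow_apply_zero_site` (`PivotalFromSeparatedArms.lean`);
`real_pivEvent_ge`, `real_pivHalfGlue_true/false`, `real_pivFrameEvent_ge`,
`real_setOf_relabel_shift_mem` (`PivotalLowerBoundFromSeparation.lean`); `sepFourArm`, `readFrame`,
`rot_apply_formula` (`ArmSeparationFourArm.lean`, `ArmSeparationRotate.lean`); `paraFourArms`,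
`ParaHalfArm`, `isPivotal_triLRCrossing_of_mem_paraFourArms` (`ParaPivotalArms.lean`);
`Werner2009_fourArm_quasiMult_of_separation` (`NearCriticalFourArmQuasiMult.lean`);
`Werner2009_lemma62_of_quasiMult_of_rhombus_pivotal` (`RhombusPivotalSumWerner.lean`);
`charLengthW_le_charLength_of_gt`, `exists_pow_le_triLRCrossingProb_below`, `tri_rsw_half_holds`,
`armEvent_mono_holds`, `fourArmProbAt`, `charLengthW`. Mathlib: nothing beyond the imports.
-/

noncomputable section

open Set MeasureTheory
open scoped unitInterval

namespace Literature.Probability.Percolation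

open LatticeModels

/-! ### From a path in a frame to a half-arm of a general parallelogram -/

/-- **From a path in a frame to a half-arm at `v`, general parallelogram `R(m, n)`.** An open
path of the configuration seen from `v` and read in colour `c` in the `i`-th frame, inside the
sites `x ≠ 0` with `ρ^i x + v ∈ R(m, n)`, from `e₀` to a site `y` with `ρ^i y + v` on `side`, is
carried by `ρ^i` and the translation by `v` to a half-arm of colour `c` from `side` to the
neighbour `ρ^i e₀ + v` of `v` inside `R(m, n) ∖ {v}` (the proof of `paraHalfArm_of_framePath`,
which is the case `m = 2N`, `n = N`). [cite: Nolin2008, Rem. 9 (arXiv 0711.4948: Rem. 8)] -/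
theorem paraHalfArm_of_framePath_gen {m n : ℕ} {v : Site 2} {i : ℕ} {c : Bool}
    {ω : SiteConfig (Site 2)} {side : Finset (Site 2)} {y : Site 2}
    (hP : PathIn triGraph ({x : Site 2 | x ≠ 0 ∧ triRotIsoPow i x + v ∈ rectangle m n} ∩
      readFrame i c (SiteConfig.relabel (triShiftIso (-v)).toEquiv ω)) triE0 y)
    (hy : triRotIsoPow i y + v ∈ side) (hadj : triGraph.Adj (triRotIsoPow i triE0 + v) v) :
    ParaHalfArm m n side v {z | z ∈ ω ↔ c} := by
  set ω' := SiteConfig.relabel (triShiftIso (-v)).toEquiv ω with hω'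
  have P' := pathIn_of_rotConfig_colour i c (ω := ω') hP
  have hsymm : ∀ z : Site 2, (triShiftIso (-v)).toEquiv.symm z = z + v := fun z => by
    rw [Equiv.symm_apply_eq]
    show z = z + v + -v
    abel
  have hmem : ∀ z : Site 2, z ∈ ω' ↔ z + v ∈ ω := by
    intro z
    rw [hω', SiteConfig.mem_relabel_iff, hsymm]
  have P'' := pathIn_shift v (B := ((↑(rectangle m n) : Set (Site 2)) \ {v}) ∩ {z | z ∈ ω ↔ c})
    (fun z hz => by
      obtain ⟨⟨x, ⟨hx0, hxR⟩, rfl⟩, hzc⟩ := hz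
      refine ⟨⟨hxR, ?_⟩, ?_⟩
      · intro h
        have h' : triRotIsoPow i x = 0 := by
          have : triRotIsoPow i x + v = v := h
          simpa using this
        exact hx0 ((triRotIsoPow i).injective (h'.trans (triRotIsoPow_apply_zero_site i).symm))
      · simp only [mem_setOf_eq] at hzc ⊢
        rw [← hmem]; exact hzc) P'
  exact Or.inr ⟨triRotIsoPow i y + v, hy, triRotIsoPow i triE0 + v, hadj, P''.symm⟩

/-! ### The four half-arms at an interior site of the rhombus -/

-- many `omega` calls on a large context
set_option maxHeartbeats 1600000 in
/-- **The four half-arms in the rhombus.** Let `1 ≤ q`, `64 ≤ n ≤ 64q`, `512q ≤ N`, and let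
`v = (a, b)` be a site of `[0, N]² = R(N, N)` at distance more than `N/4` from its boundary
(`N < 4a < 3N`, `N < 4b < 3N`). If the configuration seen from `v` lies in `sepFourArm n (64q)` and
in the half-arm gluing events of frames `0, 3` in colour open with targets `x₀ = N - a`, `x₀ = a`
and of frames `1, 4` in colour closed with targets `x₀ + x₁ = N - b`, `x₀ + x₁ = b`, then
`ω ∈ paraFourArms N N v`: open half-arms from the left and right sides of the rhombus to neighbours
of `v` and closed half-arms from the bottom and top sides, inside `[0, N]² ∖ {v}` (`pivFrame_path`
in the four frames, `paraHalfArm_of_framePath_gen`; the proof of `mem_paraFourArms_of_pivEvent`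
with the right target at abscissa `N - a`). (Nolin 2008, Rem. 9 and proof of Prop. 34, last
display `P̂(v ⇝⁴ ∂[0, L]²) ≍ P̂(v ⇝⁴ ∂S_{ηL}(v))`, `v ∈ [ηL, (1-η)L]²`.) [cite: Nolin2008, Rem. 9, §4.3 Prop. 12 and proof of Prop. 34 (arXiv 0711.4948: Rem. 8, Prop. 11, Prop. 32)] -/
theorem mem_paraFourArms_rhombus_of_glue {q n N a b : ℕ} (hq : 1 ≤ q) (hn : 64 ≤ n)
    (hnq : n ≤ 64 * q) (hN : 512 * q ≤ N) (ha : N < 4 * a) (ha' : 4 * a < 3 * N) (hb : N < 4 * b)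
    (hb' : 4 * b < 3 * N) {ω : SiteConfig (Site 2)}
    (h : SiteConfig.relabel (triShiftIso (-(![(a : ℤ), (b : ℤ)] : Site 2))).toEquiv ω ∈
      sepFourArm n (64 * q) ∩ (pivHalfGlue 0 true q n (N - a) ∩ pivHalfGlue 3 true q n a) ∩
        (pivHalfGlue 1 false q n (N - b) ∩ pivHalfGlue 4 false q n b)) :
    ω ∈ paraFourArms N N ![(a : ℤ), (b : ℤ)] := by
  set v : Site 2 := ![(a : ℤ), (b : ℤ)] with hv
  set ω' := SiteConfig.relabel (triShiftIso (-v)).toEquiv ω with hω'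
  obtain ⟨⟨⟨⟨X₀, Y₀, -, hA0, hA3⟩, ⟨X₁, Y₁, -, hA1, hA4⟩⟩, hG0, hG3⟩, hG1, hG4⟩ := h
  have hv0 : v 0 = a := rfl
  have hv1 : v 1 = b := rfl
  have hq' : (1 : ℤ) ≤ q := by exact_mod_cast hq
  have hN' : 512 * (q : ℤ) ≤ N := by exact_mod_cast hN
  have ha1 : (N : ℤ) < 4 * a := by exact_mod_cast ha
  have ha2 : 4 * (a : ℤ) < 3 * N := by exact_mod_cast ha'
  have hb1 : (N : ℤ) < 4 * b := by exact_mod_cast hb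
  have hb2 : 4 * (b : ℤ) < 3 * N := by exact_mod_cast hb'
  -- the regions of the four frames
  set A : ℕ → Set (Site 2) := fun i => {x : Site 2 | x ≠ 0 ∧ triRotIsoPow i x + v ∈ rectangle N N}
    with hAdef
  -- the punctured ball `{1 ≤ |·| ≤ 72q}` lies in every region
  have hAmid : ∀ i : ℕ, ∀ x : Site 2, 1 ≤ triNorm x → triNorm x ≤ 72 * q → x ∈ A i := by
    intro i x hx1 hx2
    refine ⟨fun h0 => ?_, ?_⟩
    · rw [h0] at hx1
      have : triNorm (0 : Site 2) = 0 := by simp [triNorm]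
      rw [this] at hx1; exact absurd hx1 (by norm_num)
    · have hw := triNorm_rot i x
      have h6 := (triNorm_le_iff_lin (x := triRotIsoPow i x) (ρ := 72 * q)).1 (by rw [hw]; exact hx2)
      rw [mem_rectangle_iff]
      simp only [Pi.add_apply, hv0, hv1]
      omega
  have hAin : ∀ i : ℕ, (↑(pivInnerFinset n) : Set (Site 2)) ⊆ A i := by
    intro i x hx
    obtain ⟨h1, h2⟩ := triNorm_bounds_of_mem_pivInnerFinset (Finset.mem_coe.1 hx)
    have hcast : ((n - 1 : ℕ) : ℤ) = (n : ℤ) - 1 := by push_cast [Nat.cast_sub (by omega : 1 ≤ n)]; ring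
    rw [hcast] at h2
    have hnq' : (n : ℤ) ≤ 64 * q := by exact_mod_cast hnq
    exact hAmid i x h1 ((h2.trans (max_le (by omega) (by omega))))
  -- casts of the targets
  have hD0 : ((N - a : ℕ) : ℤ) = (N : ℤ) - a := by push_cast [Nat.cast_sub (by omega : a ≤ N)]; ring
  have hD1 : ((N - b : ℕ) : ℤ) = (N : ℤ) - b := by push_cast [Nat.cast_sub (by omega : b ≤ N)]; ring
  -- the slab rows lie in the regions
  have hS0 : ∀ x : Site 2, 64 * (q : ℤ) + 1 ≤ x 0 → -(48 * (q : ℤ)) ≤ x 1 → x 1 ≤ -(14 * (q : ℤ)) →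
      (fun x : Site 2 => x 0) x ≤ ((N - a : ℕ) : ℤ) → x ∈ A 0 := by
    intro x h1 h2 h3 h4
    rw [hD0] at h4; dsimp only at h4
    refine ⟨fun h0 => by rw [h0] at h1; simp at h1; omega, ?_⟩
    rw [mem_rectangle_iff]
    simp only [Pi.add_apply, hv0, hv1, triRotIsoPow_zero_apply]
    omega
  have hS3 : ∀ x : Site 2, 64 * (q : ℤ) + 1 ≤ x 0 → -(48 * (q : ℤ)) ≤ x 1 → x 1 ≤ -(14 * (q : ℤ)) →
      (fun x : Site 2 => x 0) x ≤ ((a : ℕ) : ℤ) → x ∈ A 3 := by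
    intro x h1 h2 h3 h4
    dsimp only at h4
    refine ⟨fun h0 => by rw [h0] at h1; simp at h1; omega, ?_⟩
    obtain ⟨-, -, -, -, -, -, r30, r31, -⟩ := rot_apply_formula x
    rw [mem_rectangle_iff]
    simp only [Pi.add_apply, hv0, hv1, r30, r31]
    omega
  have hS1 : ∀ x : Site 2, 64 * (q : ℤ) + 1 ≤ x 0 → -(48 * (q : ℤ)) ≤ x 1 → x 1 ≤ -(14 * (q : ℤ)) →
      (fun x : Site 2 => x 0 + x 1) x ≤ ((N - b : ℕ) : ℤ) → x ∈ A 1 := by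
    intro x h1 h2 h3 h4
    rw [hD1] at h4; dsimp only at h4
    refine ⟨fun h0 => by rw [h0] at h1; simp at h1; omega, ?_⟩
    obtain ⟨-, -, r10, r11, -⟩ := rot_apply_formula x
    rw [mem_rectangle_iff]
    simp only [Pi.add_apply, hv0, hv1, r10, r11]
    omega
  have hS4 : ∀ x : Site 2, 64 * (q : ℤ) + 1 ≤ x 0 → -(48 * (q : ℤ)) ≤ x 1 → x 1 ≤ -(14 * (q : ℤ)) →
      (fun x : Site 2 => x 0 + x 1) x ≤ ((b : ℕ) : ℤ) → x ∈ A 4 := by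
    intro x h1 h2 h3 h4
    dsimp only at h4
    refine ⟨fun h0 => by rw [h0] at h1; simp at h1; omega, ?_⟩
    obtain ⟨-, -, -, -, -, -, -, -, r40, r41, -⟩ := rot_apply_formula x
    rw [mem_rectangle_iff]
    simp only [Pi.add_apply, hv0, hv1, r40, r41]
    omega
  -- the four paths in the frames
  obtain ⟨y₀, hy₀, P₀⟩ := pivFrame_path hq hn hnq (D := N - a) (by omega) hA0 hG0
    (ℓ := fun x : Site 2 => x 0) (Or.inl rfl) (hAin 0) (hAmid 0) hS0
  obtain ⟨y₃, hy₃, P₃⟩ := pivFrame_path hq hn hnq (D := a) (by omega) hA3 hG3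
    (ℓ := fun x : Site 2 => x 0) (Or.inl rfl) (hAin 3) (hAmid 3) hS3
  obtain ⟨y₁, hy₁, P₁⟩ := pivFrame_path hq hn hnq (D := N - b) (by omega) hA1 hG1
    (ℓ := fun x : Site 2 => x 0 + x 1) (Or.inr rfl) (hAin 1) (hAmid 1) hS1
  obtain ⟨y₄, hy₄, P₄⟩ := pivFrame_path hq hn hnq (D := b) (by omega) hA4 hG4
    (ℓ := fun x : Site 2 => x 0 + x 1) (Or.inr rfl) (hAin 4) (hAmid 4) hS4
  -- the images of `e₀` in the four frames are neighbours of the origin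
  obtain ⟨-, -, e10, e11, -, -, e30, e31, e40, e41, -⟩ := rot_apply_formula (triE0 : Site 2)
  simp only [triE0_apply_zero, triE0_apply_one] at e10 e11 e30 e31 e40 e41
  have hadj0 : triGraph.Adj (triRotIsoPow 0 triE0 + v) v := by
    rw [triRotIsoPow_zero_apply, add_comm]; exact (triGraph_adj_add_triE0 v).symm
  have hadj3 : triGraph.Adj (triRotIsoPow 3 triE0 + v) v := by
    have e3 : triRotIsoPow 3 triE0 + v = v - triE0 := by
      ext j; fin_cases j
      · show (triRotIsoPow 3 triE0) 0 + v 0 = v 0 - triE0 0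
        rw [e30, triE0_apply_zero]; ring
      · show (triRotIsoPow 3 triE0) 1 + v 1 = v 1 - triE0 1
        rw [e31, triE0_apply_one]; ring
    rw [e3]
    have := triGraph_adj_add_triE0 (v - triE0)
    rwa [sub_add_cancel] at this
  have hadj1 : triGraph.Adj (triRotIsoPow 1 triE0 + v) v := by
    have e1 : triRotIsoPow 1 triE0 + v = v + triE1 := by
      ext j; fin_cases j
      · show (triRotIsoPow 1 triE0) 0 + v 0 = v 0 + triE1 0
        rw [e10, triE1_apply_zero]; ring
      · show (triRotIsoPow 1 triE0) 1 + v 1 = v 1 + triE1 1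
        rw [e11, triE1_apply_one]; ring
    rw [e1]; exact (triGraph_adj_add_triE1 v).symm
  have hadj4 : triGraph.Adj (triRotIsoPow 4 triE0 + v) v := by
    have e4 : triRotIsoPow 4 triE0 + v = v - triE1 := by
      ext j; fin_cases j
      · show (triRotIsoPow 4 triE0) 0 + v 0 = v 0 - triE1 0
        rw [e40, triE1_apply_zero]; ring
      · show (triRotIsoPow 4 triE0) 1 + v 1 = v 1 - triE1 1
        rw [e41, triE1_apply_one]; ring
    rw [e4]
    have := triGraph_adj_add_triE1 (v - triE1)
    rwa [sub_add_cancel] at this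
  -- the endpoints lie on the four sides of the rhombus
  have hside0 : triRotIsoPow 0 y₀ + v ∈ rightSide N N := by
    have hR := P₀.right_mem.1.2
    rw [rightSide, Finset.mem_filter]
    refine ⟨hR, ?_⟩
    simp only [Pi.add_apply, hv0, triRotIsoPow_zero_apply, hy₀, hD0]
    ring
  have hside3 : triRotIsoPow 3 y₃ + v ∈ leftSide N N := by
    have hR := P₃.right_mem.1.2
    obtain ⟨-, -, -, -, -, -, r30, -, -⟩ := rot_apply_formula y₃
    rw [leftSide, Finset.mem_filter]
    refine ⟨hR, ?_⟩
    simp only [Pi.add_apply, hv0, r30, hy₃]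
    ring
  have hside1 : triRotIsoPow 1 y₁ + v ∈ topSide N N := by
    have hR := P₁.right_mem.1.2
    obtain ⟨-, -, -, r11, -⟩ := rot_apply_formula y₁
    rw [topSide, Finset.mem_filter]
    refine ⟨hR, ?_⟩
    simp only [Pi.add_apply, hv1, r11, hy₁, hD1]
    ring
  have hside4 : triRotIsoPow 4 y₄ + v ∈ bottomSide N N := by
    have hR := P₄.right_mem.1.2
    obtain ⟨-, -, -, -, -, -, -, -, -, r41, -⟩ := rot_apply_formula y₄
    rw [bottomSide, Finset.mem_filter]
    refine ⟨hR, ?_⟩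
    simp only [Pi.add_apply, hv1, r41, hy₄]
    ring
  -- the four half-arms
  have H0 := paraHalfArm_of_framePath_gen (ω := ω) P₀ hside0 hadj0
  have H3 := paraHalfArm_of_framePath_gen (ω := ω) P₃ hside3 hadj3
  have H1 := paraHalfArm_of_framePath_gen (ω := ω) P₁ hside1 hadj1
  have H4 := paraHalfArm_of_framePath_gen (ω := ω) P₄ hside4 hadj4
  rw [setOf_mem_iff_true] at H0 H3
  rw [setOf_mem_iff_false] at H1 H4
  exact ⟨H3, H0, H4, H1⟩

/-- **Pivotality in the rhombus.** Under the hypotheses of `mem_paraFourArms_rhombus_of_glue`,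
`v = (a, b)` is pivotal for the left–right crossing `LR(N, N)` of the rhombus `[0, N]²`
(`isPivotal_triLRCrossing_of_mem_paraFourArms`: four half-arms of alternating colours to the four
sides make the site pivotal; Nolin 2008, Rem. 9). [cite: Nolin2008, Rem. 9 and proof of Prop. 34, last display (arXiv 0711.4948: Rem. 8, Prop. 32)] -/
theorem isPivotal_rhombus_of_glue {q n N a b : ℕ} (hq : 1 ≤ q) (hn : 64 ≤ n) (hnq : n ≤ 64 * q)
    (hN : 512 * q ≤ N) (ha : N < 4 * a) (ha' : 4 * a < 3 * N) (hb : N < 4 * b) (hb' : 4 * b < 3 * N)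
    {ω : SiteConfig (Site 2)}
    (h : SiteConfig.relabel (triShiftIso (-(![(a : ℤ), (b : ℤ)] : Site 2))).toEquiv ω ∈
      sepFourArm n (64 * q) ∩ (pivHalfGlue 0 true q n (N - a) ∩ pivHalfGlue 3 true q n a) ∩
        (pivHalfGlue 1 false q n (N - b) ∩ pivHalfGlue 4 false q n b)) :
    IsPivotal (triLRCrossing N N) ![(a : ℤ), (b : ℤ)] ω := by
  refine isPivotal_triLRCrossing_of_mem_paraFourArms ?_
    (mem_paraFourArms_rhombus_of_glue hq hn hnq hN ha ha' hb hb' h)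
  rw [mem_rectangle_iff]
  simp only [site_mk_apply_zero, site_mk_apply_one]
  omega

/-! ### The rhombus interior pivotal lower bound from near-critical four-arm separation -/

/-- **Interior sites of the rhombus are pivotal with probability `≥ cst · π̂_t(r₀, N)` below
`L(p)`, from near-critical four-arm separation** (Nolin 2008, proof of Prop. 34, last display:
`P̂(v ⇝^{4,σ₄,Ī} ∂[0, L]²) ≍ P̂(v ⇝^{4,σ₄} ∂S_{ηL}(v))` for `v ∈ [ηL, (1-η)L]²`, "by Theorem 11";
Werner 2009, proof of Lemma 6.2, lower bound). IF `c · π̂_t(n, N) ≤ P_t(sepFourArm n N)` for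
`n₀ ≤ n`, `2n ≤ N ≤ L(t, ε)` (`t ∈ [1/2, 1/2 + δ)`, every small `ε`; Nolin's Thm. 11
[arXiv 0711.4948: Thm. 10] for `j = 4`), THEN for every small `ε` and every `r₀ ≥ r₁` there are
`n₁`, `δ > 0`, `c' > 0` with `c' · π̂_t(r₀, N) ≤ P_t(v is pivotal for LR(N, N))` for
`n₁ ≤ N ≤ L(t, ε)` (no upper restriction at `t = 1/2`) and every site `v` with
`N/4 < v₀, v₁ < 3N/4` — the hypothesis `hP` of `Werner2009_lemma62_of_quasiMult_of_rhombus_pivotal`.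
Proof: that of `Werner2009_pivotal_lowerBound_of_separation` with the corridor lengths
`N - a, a, N - b, b` and `isPivotal_rhombus_of_glue`. [cite: Nolin2008, §7.3 proof of Prop. 34 (last display), Rem. 9, Thm. 11, Prop. 12, Lemma 13 (arXiv 0711.4948: Prop. 32, Rem. 8, Thm. 10, Prop. 11, Lemma 12)] [cite: WernerPCMI2009, Lecture 6, proof of Lemma 6.2 (lower bound)] [cite: KestenScalingCMP1987, Lemmas 4–6 and 8] -/
theorem rhombus_pivotal_lowerBound_of_separation
    (hsep : ∃ ε₁ > (0 : ℝ), ∀ ⦃ε : ℝ⦄, 0 < ε → ε < ε₁ →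
      ∃ n₀ : ℕ, ∃ δ > (0 : ℝ), ∃ c > (0 : ℝ),
        ∀ t : unitInterval, 1 / 2 ≤ (t : ℝ) → (t : ℝ) < 1 / 2 + δ →
          ∀ n N : ℕ, n₀ ≤ n → 2 * n ≤ N → (1 / 2 < (t : ℝ) → N ≤ charLengthW ε t) →
            c * fourArmProbAt t n N ≤ (triSitePercolation t).real (sepFourArm n N)) :
    ∃ ε₁ > (0 : ℝ), ∀ ⦃ε : ℝ⦄, 0 < ε → ε < ε₁ →
      ∃ r₁ : ℕ, ∀ r₀ ≥ r₁, ∃ n₁ : ℕ, ∃ δ > (0 : ℝ), ∃ c > (0 : ℝ),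
        ∀ t : unitInterval, 1 / 2 ≤ (t : ℝ) → (t : ℝ) < 1 / 2 + δ →
          ∀ N : ℕ, n₁ ≤ N → (1 / 2 < (t : ℝ) → N ≤ charLengthW ε t) →
            ∀ v : Site 2, (N : ℤ) < 4 * v 0 → 4 * v 0 < 3 * N → (N : ℤ) < 4 * v 1 → 4 * v 1 < 3 * N →
              c * fourArmProbAt t r₀ N ≤
                (triSitePercolation t).real {ω | IsPivotal (triLRCrossing N N) v ω} := by
  obtain ⟨ε₁, hε₁, H⟩ := hsep
  refine ⟨ε₁, hε₁, fun ε hε hεε₁ => ?_⟩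
  obtain ⟨n₀, δs, hδs, cs, hcs, Hs⟩ := H hε hεε₁
  -- RSW below Werner's length, and at `1/2`
  obtain ⟨ε', hε', hε'2, hLen⟩ := charLengthW_le_charLength_of_gt hε
  obtain ⟨η, hη, -, hRSW⟩ := exists_pow_le_triLRCrossingProb_below hε' hε'2
  obtain ⟨c₀, hc₀, h0⟩ := tri_rsw_half_holds 2046 (by norm_num)
  set θ : ℝ := min (η ^ 2045) c₀ with hθ
  have hθ0 : 0 < θ := lt_min (pow_pos hη _) hc₀
  refine ⟨max n₀ 64, fun r₀ hr₀ => ?_⟩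
  have hr₀n : n₀ ≤ r₀ := le_trans (le_max_left _ _) hr₀
  have hr₀64 : 64 ≤ r₀ := le_trans (le_max_right _ _) hr₀
  -- the lower bound of each gluing event, and of the four of them
  set g : ℝ := (1 / 4 : ℝ) ^ (pivInnerFinset r₀).card * θ ^ 33 with hg
  have hg0 : 0 < g := by positivity
  set K : ℝ := g * g * (g * g) with hK
  have hK0 : 0 < K := by positivity
  refine ⟨512 * (r₀ + 1), min δs (1 / 4), lt_min hδs (by norm_num), cs * K, mul_pos hcs hK0,
    fun t ht1 ht2 N hN hNL v hv0 hv0' hv1 hv1' => ?_⟩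
  have htδ : (t : ℝ) < 1 / 2 + δs := lt_of_lt_of_le ht2 (by linarith [min_le_left δs (1 / 4)])
  have ht34 : (t : ℝ) < 3 / 4 := by linarith [min_le_right δs (1 / 4)]
  -- the scale `q = ⌊N / 512⌋`
  set q : ℕ := N / 512 with hq
  have hdm := Nat.div_add_mod N 512
  have hml := Nat.mod_lt N (by norm_num : 512 > 0)
  have hqN : 512 * q ≤ N := by omega
  have hNq : N < 512 * (q + 1) := by omega
  have hq65 : r₀ + 1 ≤ q := by
    rw [hq]; exact (Nat.le_div_iff_mul_le (by norm_num)).2 (by linarith)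
  have hq1 : 1 ≤ q := by omega
  have hr₀q : r₀ ≤ 64 * q := by omega
  have h2r₀ : 2 * r₀ ≤ 64 * q := by omega
  have h64N : 64 * q ≤ N := by omega
  -- the site as a pair of naturals
  obtain ⟨a, ha⟩ : ∃ a : ℕ, v 0 = a := ⟨(v 0).toNat, (Int.toNat_of_nonneg (by omega)).symm⟩
  obtain ⟨b, hb⟩ : ∃ b : ℕ, v 1 = b := ⟨(v 1).toNat, (Int.toNat_of_nonneg (by omega)).symm⟩
  rw [ha] at hv0 hv0'
  rw [hb] at hv1 hv1'
  have ha1 : N < 4 * a := by exact_mod_cast hv0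
  have ha2 : 4 * a < 3 * N := by exact_mod_cast hv0'
  have hb1 : N < 4 * b := by exact_mod_cast hv1
  have hb2 : 4 * b < 3 * N := by exact_mod_cast hv1'
  have hv : v = ![(a : ℤ), (b : ℤ)] := by
    ext j; fin_cases j
    · simpa using ha
    · simpa using hb
  subst hv
  -- the gluing event seen from `v`
  set E : Set (SiteConfig (Site 2)) :=
    sepFourArm r₀ (64 * q) ∩ (pivHalfGlue 0 true q r₀ (N - a) ∩ pivHalfGlue 3 true q r₀ a) ∩
      (pivHalfGlue 1 false q r₀ (N - b) ∩ pivHalfGlue 4 false q r₀ b) with hE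
  -- (1) the deterministic inclusion and translation invariance
  have hincl : {ω : SiteConfig (Site 2) |
      SiteConfig.relabel (triShiftIso (-(![(a : ℤ), (b : ℤ)] : Site 2))).toEquiv ω ∈ E} ⊆
      {ω | IsPivotal (triLRCrossing N N) ![(a : ℤ), (b : ℤ)] ω} :=
    fun ω hω => isPivotal_rhombus_of_glue hq1 hr₀64 hr₀q hqN ha1 ha2 hb1 hb2 hω
  have step1 : (triSitePercolation t).real E ≤
      (triSitePercolation t).real {ω | IsPivotal (triLRCrossing N N) ![(a : ℤ), (b : ℤ)] ω} := by
    rw [← real_setOf_relabel_shift_mem t (![(a : ℤ), (b : ℤ)]) E]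
    exact measureReal_mono hincl (measure_ne_top _ _)
  -- (2) Nolin's Lemma 13
  have step2 := real_pivEvent_ge t hq1 hr₀64 hr₀q (N - a) a (N - b) b
  -- (3) the gluing events
  have hquarter : ∀ p : unitInterval, (p = t ∨ p = σ t) → (1 / 4 : ℝ) ≤ p := by
    rintro p (rfl | rfl)
    · linarith
    · rw [unitInterval.coe_symm_eq]; linarith
  have hslab : ∀ D : ℕ, D ≤ 2 * N → ∀ p : unitInterval, (p = t ∨ p = σ t) → ∀ k : ℕ, k < 33 →
      θ ≤ (triSitePercolation p).real (triHCross (64 * (q : ℤ) + 1) ((-48 + (k : ℤ)) * q) D q) := by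
    intro D hD p hp k _
    rw [triSitePercolation_real_triHCross]
    have hDq : D ≤ 2046 * q := by omega
    have hanti : triLRCrossingProb p (2046 * q) q ≤ triLRCrossingProb p D q :=
      triLRCrossingProb_anti_width p hDq q
    refine le_trans ?_ hanti
    rcases eq_or_lt_of_le ht1 with heq | hgt
    · -- `t = 1/2`
      have ht : t = half := Subtype.ext (by rw [coe_half]; exact heq.symm)
      have hp' : p = half := by
        rcases hp with rfl | rfl
        · exact ht
        · rw [ht, symm_half]
      have hfl : ⌊(2046 : ℝ) * q⌋₊ = 2046 * q := by
        have : (2046 : ℝ) * q = ((2046 * q : ℕ) : ℝ) := by push_cast; ring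
        rw [this, Nat.floor_natCast]
      have := (h0 q (by rw [hfl]; omega)).1
      rw [hfl] at this
      rw [hp']
      exact (min_le_right _ _).trans this
    · -- `t > 1/2`: below Nolin's length
      have hqL : q < charLength ε' t :=
        lt_of_lt_of_le (by omega : q < N) ((hNL hgt).trans (hLen t hgt ht34))
      have hpmin : min t (σ t) ≤ p := by
        rcases hp with rfl | rfl
        · exact min_le_left _ _
        · exact min_le_right _ _
      have := hRSW t p hpmin q hq1 hqL 2045 (2046 * q) (by norm_num) (by omega)
      exact (min_le_left _ _).trans this
  have hglue : ∀ D : ℕ, D ≤ 2 * N → ∀ p : unitInterval, (p = t ∨ p = σ t) →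
      g ≤ (triSitePercolation p).real (pivFrameEvent q r₀ D) := by
    intro D hD p hp
    calc g = (1 / 4 : ℝ) ^ (pivInnerFinset r₀).card * θ ^ 33 := rfl
      _ ≤ (p : ℝ) ^ (pivInnerFinset r₀).card * θ ^ 33 :=
          mul_le_mul_of_nonneg_right (pow_le_pow_left₀ (by norm_num) (hquarter p hp) _) (by positivity)
      _ ≤ _ := real_pivFrameEvent_ge p r₀ hθ0.le (hslab D hD p hp)
  have g0 : g ≤ (triSitePercolation t).real (pivHalfGlue 0 true q r₀ (N - a)) := by
    rw [real_pivHalfGlue_true]; exact hglue _ (by omega) t (Or.inl rfl)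
  have g3 : g ≤ (triSitePercolation t).real (pivHalfGlue 3 true q r₀ a) := by
    rw [real_pivHalfGlue_true]; exact hglue _ (by omega) t (Or.inl rfl)
  have g1 : g ≤ (triSitePercolation t).real (pivHalfGlue 1 false q r₀ (N - b)) := by
    rw [real_pivHalfGlue_false]; exact hglue _ (by omega) (σ t) (Or.inr rfl)
  have g4 : g ≤ (triSitePercolation t).real (pivHalfGlue 4 false q r₀ b) := by
    rw [real_pivHalfGlue_false]; exact hglue _ (by omega) (σ t) (Or.inr rfl)
  have hKle : K ≤ ((triSitePercolation t).real (pivHalfGlue 0 true q r₀ (N - a)) *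
        (triSitePercolation t).real (pivHalfGlue 3 true q r₀ a)) *
      ((triSitePercolation t).real (pivHalfGlue 1 false q r₀ (N - b)) *
        (triSitePercolation t).real (pivHalfGlue 4 false q r₀ b)) :=
    mul_le_mul (mul_le_mul g0 g3 hg0.le measureReal_nonneg) (mul_le_mul g1 g4 hg0.le measureReal_nonneg)
      (by positivity) (mul_nonneg measureReal_nonneg measureReal_nonneg)
  -- (4) separation at the scales `(r₀, 64q)` and monotonicity in the outer radius
  have hsepb := Hs t ht1 htδ r₀ (64 * q) hr₀n h2r₀ (fun hgt => le_trans h64N (hNL hgt))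
  have hmono : fourArmProbAt t r₀ N ≤ fourArmProbAt t r₀ (64 * q) :=
    measureReal_mono (armEvent_mono_holds _ hr₀q h64N) (measure_ne_top _ _)
  -- (5) the chain
  calc cs * K * fourArmProbAt t r₀ N
      ≤ cs * K * fourArmProbAt t r₀ (64 * q) := mul_le_mul_of_nonneg_left hmono (by positivity)
    _ = cs * fourArmProbAt t r₀ (64 * q) * K := by ring
    _ ≤ (triSitePercolation t).real (sepFourArm r₀ (64 * q)) * K :=
        mul_le_mul_of_nonneg_right hsepb hK0.le
    _ ≤ (triSitePercolation t).real (sepFourArm r₀ (64 * q)) *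
          (((triSitePercolation t).real (pivHalfGlue 0 true q r₀ (N - a)) *
              (triSitePercolation t).real (pivHalfGlue 3 true q r₀ a)) *
            ((triSitePercolation t).real (pivHalfGlue 1 false q r₀ (N - b)) *
              (triSitePercolation t).real (pivHalfGlue 4 false q r₀ b))) :=
        mul_le_mul_of_nonneg_left hKle measureReal_nonneg
    _ ≤ (triSitePercolation t).real E := step2
    _ ≤ _ := step1

/-! ### `Werner2009_lemma62` from near-critical four-arm separation -/

/-- **Werner's Lemma 6.2 for the rhombus (`Werner2009_lemma62`) from near-critical four-arm
separation.** IF the well-separated four-arm event with alternating colours is comparable to the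
four-arm event uniformly below Werner's length — for every small `ε` there are `n₀`, a right
neighbourhood `[1/2, 1/2 + δ)` of `1/2` and `c > 0` with `c · π̂_t(n, N) ≤ P_t(sepFourArm n N)` for
`n₀ ≤ n`, `2n ≤ N`, `N ≤ L(t, ε)` if `t > 1/2` (Nolin 2008, Thm. 11 [arXiv 0711.4948: Thm. 10] for
`j = 4`; Werner 2009, Prop. 6.1) — THEN `Werner2009_lemma62` holds: for every `ε ∈ (0, 1/2)`,
`c N² π₄(r₀, N) ≤ Σ_{v ∈ [0,N]²} P_t(v pivotal for LR([0,N]²)) ≤ C N² π₄(r₀, N)` uniformly for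
`|t - 1/2| < δ` and `n₁ ≤ N ≤ L_ε(t)`. Assembly: `Werner2009_lemma62_of_quasiMult_of_rhombus_pivotal`
(`RhombusPivotalSumWerner.lean`) fed with `Werner2009_fourArm_quasiMult_of_separation`
(Werner's Cor. 6.2 from separation, `NearCriticalFourArmQuasiMult.lean`) and
`rhombus_pivotal_lowerBound_of_separation`. The discharge `Werner2009_lemma62_holds` is this
theorem applied to the near-critical four-arm separation theorem once that lands. [cite: WernerPCMI2009, Lecture 6, Lemma 6.2, with §4 Prop. 6.1 and Cor. 6.2] [cite: Nolin2008, §7.3 Prop. 34, its proof and Remark 35; Thm. 11, Prop. 12, Lemma 13 (arXiv 0711.4948: Prop. 32, Remark 34; Thm. 10, Prop. 11, Lemma 12)] -/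
theorem Werner2009_lemma62_of_separation
    (hsep : ∃ ε₁ > (0 : ℝ), ∀ ⦃ε : ℝ⦄, 0 < ε → ε < ε₁ →
      ∃ n₀ : ℕ, ∃ δ > (0 : ℝ), ∃ c > (0 : ℝ),
        ∀ t : unitInterval, 1 / 2 ≤ (t : ℝ) → (t : ℝ) < 1 / 2 + δ →
          ∀ n N : ℕ, n₀ ≤ n → 2 * n ≤ N → (1 / 2 < (t : ℝ) → N ≤ charLengthW ε t) →
            c * fourArmProbAt t n N ≤ (triSitePercolation t).real (sepFourArm n N)) :
    Werner2009_lemma62 :=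
  Werner2009_lemma62_of_quasiMult_of_rhombus_pivotal (Werner2009_fourArm_quasiMult_of_separation hsep)
    (rhombus_pivotal_lowerBound_of_separation hsep)

end Literature.Probability.Percolation
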